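import Summits.BirchSwinnertonDyer.BirchSwinnertonDyer.Theorems.PrintCf2RamifiedOffTYZCasselsTatePin
import Literature.NumberTheory.EllipticCurves.SecondDescentShaExponentProofs
import HarnessLib

/-!
# The Cassels–Tate PIN, part 3: category-D-type Selmer excess two at ANY rank (crux stmt-BirchSwinnertonDyer-20509
# `RamifiedOffTYZOfFacts`, line `offtyz-v7`, LEAD cruxlead-20509 g21, cycle 22) — the partner curves of the induction (I) of `cassels-tate-entries`

HONEST FRAMING (cell `bsd-print-cf2`, route `PrintCf2`; `--supports stmt-BirchSwinnertonDyer-20509`; `def`-free, no `sorry`; the only named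
fact is the HYPOTHESIS `casselsTate_pairing_levelKernel ℚ` where a dichotomy is claimed). BSD is not proved by any of this; 20509 / 23431 OPEN.

Part 2 (`…CasselsTatePinJumpOne.lean`) treated `E_n` of RANK ONE with `#Sel₂(E_n) = 2⁵`.  The induction (I) of the idea card
`Cruxes/RamifiedJumpOneLevelTwoOfFacts/Ideas/cassels-tate-entries.md` also reads the level-two bit of the PROPER DIVISORS of `n` — rank-ZERO
partner curves `E_d` with `#Sel₂(E_d) = 2⁴` (e.g. `E_l`, `l ≡ 1 (mod 8)` prime: Zhao's level-two bit `4 ∣ 𝓛(l)`), whose `Ш(E_d)[2]` is again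
`(ℤ/2)²`.  This part states the same three facts for `E_n`, `n` square-free, of ANY Mordell–Weil rank `r` with Selmer excess two,
`#Sel₂(E_n) = 2^{4+r}` (so `#Ш(E_n)[2] = 4`):

* `natCard_sha_two_eq_four_of_excess_two` — `#Ш(E_n)[2] = 4`.
* `natCard_selmerGroup_four_eq_pow_iff_of_excess_two` — `#Sel₄(E_n) = 2^{4+2r} ⟺ Ш(E_n)[4] = Ш(E_n)[2]` (PIN regime; fact-free).
* `natCard_selmerGroup_four_eq_pow_add_two_iff_of_excess_two` — `#Sel₄(E_n) = 2^{6+2r} ⟺ Ш(E_n)[2] ≤ 2·Ш(E_n)[4]` (ZERO regime; fact-free).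
* `natCard_selmerGroup_four_eq_or_of_excess_two` — granted the CT fact, **`#Sel₄(E_n) = 2^{4+2r} ∨ #Sel₄(E_n) = 2^{6+2r}`**.
* `natCard_selmerGroup_four_eq_or_of_rank_zero` — the rank-zero partner case: `#Sel₂(E_n) = 2⁴`, `rank 0` ⟹ `#Sel₄(E_n) ∈ {2⁴, 2⁶}`.

References: Cassels 1962 (Arithmetic IV); Milne *ADT* I §6; Silverman *AEC* X §4 (Thm X.4.2); Heath-Brown 1994 §1.
-/

noncomputable section

open scoped Classical

open WeierstrassCurve Literature.NumberTheory.EllipticCurves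

set_option autoImplicit false

namespace Summit.BirchSwinnertonDyer.PrintCf2.CasselsTatePin

section AnyRank

variable {n : ℕ}

/-- **`#Ш(E_n)[2] = 4`** for square-free `n` with `#Sel₂(E_n) = 2^{4 + rank}` (Selmer excess two: the `2`-descent count
`2^{rk} · 4 · #Ш[2] = #Sel₂`). [cite: SilvermanAEC2009, Thm. X.4.2] [cite: HeathBrown1994SelmerCongruentII, §1] -/
theorem natCard_sha_two_eq_four_of_excess_two (hsq : Squarefree n) [(congruentNumberCurve n).IsElliptic]
    (h₂ : Nat.card ((congruentNumberCurve n).selmerGroup 2) = 2 ^ (4 + (congruentNumberCurve n).mordellWeilRank)) :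
    Nat.card (AddSubgroup.torsionBy (congruentNumberCurve n).sha (2 : ℤ)) = 4 := by
  have h' := (MonskySelmerParity.natCard_shaTorsionBy_two_eq_pow hsq.ne_zero
    (s := 2 + (congruentNumberCurve n).mordellWeilRank) (by rw [h₂]; ring_nf)).2
  rw [show 2 + (congruentNumberCurve n).mordellWeilRank - (congruentNumberCurve n).mordellWeilRank = 2 by omega] at h'
  simpa using h'

/-- **`#Sel₄(E_n) = 2^{4+2r} ⟺ Ш(E_n)[4] = Ш(E_n)[2]`** for square-free `n` of rank `r` with `#Sel₂(E_n) = 2^{4+r}` (fact-free; the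
`4`-descent count `4^{r} · 4 · #Ш[4] = #Sel₄`). [cite: SilvermanAEC2009, Thm. X.4.2] [cite: HeathBrown1994SelmerCongruentII, §1] -/
theorem natCard_selmerGroup_four_eq_pow_iff_of_excess_two (hsq : Squarefree n) [(congruentNumberCurve n).IsElliptic]
    (h₂ : Nat.card ((congruentNumberCurve n).selmerGroup 2) = 2 ^ (4 + (congruentNumberCurve n).mordellWeilRank)) :
    Nat.card ((congruentNumberCurve n).selmerGroup 4) = 2 ^ (4 + 2 * (congruentNumberCurve n).mordellWeilRank) ↔
      ∀ w : (congruentNumberCurve n).sha, (4 : ℤ) • w = 0 → (2 : ℤ) • w = 0 := by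
  have hsha₂ := natCard_sha_two_eq_four_of_excess_two hsq h₂
  haveI : Finite (AddSubgroup.torsionBy (congruentNumberCurve n).sha (2 : ℤ)) :=
    Nat.finite_of_card_ne_zero (by rw [hsha₂]; norm_num)
  have hle : AddSubgroup.torsionBy (congruentNumberCurve n).sha (2 : ℤ) ≤
      AddSubgroup.torsionBy (congruentNumberCurve n).sha (4 : ℤ) :=
    Submodule.torsionBy_le_torsionBy_of_dvd (2 : ℤ) 4 (by norm_num)
  constructor
  · intro h₄ w hw
    have h := (natCard_shaTorsionBy_four_eq_pow hsq (s := 2 + 2 * (congruentNumberCurve n).mordellWeilRank)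
      (by rw [h₄]; ring_nf)).2
    rw [show 2 + 2 * (congruentNumberCurve n).mordellWeilRank - 2 * (congruentNumberCurve n).mordellWeilRank = 2 by omega]
      at h
    norm_num only [] at h
    haveI : Finite (AddSubgroup.torsionBy (congruentNumberCurve n).sha (4 : ℤ)) :=
      Nat.finite_of_card_ne_zero (by rw [h]; norm_num)
    have heq := AddSubgroup.eq_of_le_of_card_ge hle (by rw [h, hsha₂])
    have hw' : w ∈ AddSubgroup.torsionBy (congruentNumberCurve n).sha (4 : ℤ) :=
      (mem_sha_torsionBy_iff _ 4 w).mpr hw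
    rw [← heq] at hw'
    exact (mem_sha_torsionBy_iff _ 2 w).mp hw'
  · intro hexp
    have heq : AddSubgroup.torsionBy (congruentNumberCurve n).sha (4 : ℤ) =
        AddSubgroup.torsionBy (congruentNumberCurve n).sha (2 : ℤ) :=
      le_antisymm (fun w hw => (mem_sha_torsionBy_iff _ 2 w).mpr
        (hexp w ((mem_sha_torsionBy_iff _ 4 w).mp hw))) hle
    have hsha₄ : Nat.card (AddSubgroup.torsionBy (congruentNumberCurve n).sha ((4 : ℕ) : ℤ)) = 4 := by
      rw [Nat.cast_ofNat, heq, hsha₂]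
    have hsel := (congruentNumberCurve n).natCard_selmerGroup_eq_of_natCard_eq four_ne_zero
      (t := 4) (c := 4) (by convert natCard_torsionBy_four_congruentNumberCurve hsq; norm_num) hsha₄
    simp only [Nat.cast_ofNat] at hsel
    rw [hsel, show (4 : ℕ) = 2 ^ 2 by norm_num, ← pow_mul, ← pow_add, ← pow_add]
    ring_nf

/-- **`#Sel₄(E_n) = 2^{6+2r} ⟺ Ш(E_n)[2] ≤ 2·Ш(E_n)[4]`** for square-free `n` of rank `r` with `#Sel₂(E_n) = 2^{4+r}` (fact-free; with
`g = 2· : Ш[4] → Ш[2]`, `ker g = Ш[2]`, `#Sel₄ = 4^r · 4 · 4 · #g(Ш[4])`). [cite: SilvermanAEC2009, Thm. X.4.2] [cite: HeathBrown1994SelmerCongruentII, §1] -/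
theorem natCard_selmerGroup_four_eq_pow_add_two_iff_of_excess_two (hsq : Squarefree n)
    [(congruentNumberCurve n).IsElliptic]
    (h₂ : Nat.card ((congruentNumberCurve n).selmerGroup 2) = 2 ^ (4 + (congruentNumberCurve n).mordellWeilRank)) :
    Nat.card ((congruentNumberCurve n).selmerGroup 4) = 2 ^ (6 + 2 * (congruentNumberCurve n).mordellWeilRank) ↔
      ∀ x : (congruentNumberCurve n).sha, (2 : ℤ) • x = 0 →
        ∃ w : (congruentNumberCurve n).sha, (4 : ℤ) • w = 0 ∧ (2 : ℤ) • w = x := by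
  have hsha₂ := natCard_sha_two_eq_four_of_excess_two hsq h₂
  haveI hfin2 : Finite (AddSubgroup.torsionBy (congruentNumberCurve n).sha (2 : ℤ)) :=
    Nat.finite_of_card_ne_zero (by rw [hsha₂]; norm_num)
  have hle : AddSubgroup.torsionBy (congruentNumberCurve n).sha (2 : ℤ) ≤
      AddSubgroup.torsionBy (congruentNumberCurve n).sha (4 : ℤ) :=
    Submodule.torsionBy_le_torsionBy_of_dvd (2 : ℤ) 4 (by norm_num)
  -- `g = 2· : Ш[4] → Ш[2]`
  let g : AddSubgroup.torsionBy (congruentNumberCurve n).sha (4 : ℤ) →+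
      AddSubgroup.torsionBy (congruentNumberCurve n).sha (2 : ℤ) :=
    ((zsmulAddGroupHom 2 : (congruentNumberCurve n).sha →+ (congruentNumberCurve n).sha).comp
      (AddSubgroup.torsionBy (congruentNumberCurve n).sha (4 : ℤ)).subtype).codRestrict _
      fun w => (mem_sha_torsionBy_iff _ 2 _).mpr (by
        change (2 : ℤ) • ((2 : ℤ) • (w : (congruentNumberCurve n).sha)) = 0
        rw [smul_smul]
        exact (mem_sha_torsionBy_iff _ 4 _).mp w.2)
  have hg : ∀ w, ((g w : AddSubgroup.torsionBy (congruentNumberCurve n).sha (2 : ℤ)) :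
      (congruentNumberCurve n).sha) = (2 : ℤ) • (w : (congruentNumberCurve n).sha) := fun w => rfl
  have hker : g.ker = (AddSubgroup.torsionBy (congruentNumberCurve n).sha (2 : ℤ)).addSubgroupOf
      (AddSubgroup.torsionBy (congruentNumberCurve n).sha (4 : ℤ)) := by
    ext w
    rw [AddMonoidHom.mem_ker, AddSubgroup.mem_addSubgroupOf, mem_sha_torsionBy_iff, ← hg]
    exact ⟨fun h => congrArg Subtype.val h, fun h => Subtype.ext h⟩
  have hkcard : Nat.card g.ker = 4 := by
    rw [hker, Nat.card_congr (AddSubgroup.addSubgroupOfEquivOfLe hle).toEquiv, hsha₂]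
  have hmul : 4 * Nat.card g.range =
      Nat.card (AddSubgroup.torsionBy (congruentNumberCurve n).sha (4 : ℤ)) := by
    rw [← hkcard, ← AddSubgroup.index_ker, AddSubgroup.card_mul_index]
  -- the `4`-descent count `4^r · 4 · #Ш[4] = #Sel₄`
  have hcount := (congruentNumberCurve n).natCard_selmerGroup_eq_of_natCard_eq four_ne_zero
    (t := 4) (c := Nat.card (AddSubgroup.torsionBy (congruentNumberCurve n).sha (4 : ℤ)))
    (by convert natCard_torsionBy_four_congruentNumberCurve hsq; norm_num) (by norm_num)
  simp only [Nat.cast_ofNat] at hcount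
  have h4pow : (4 : ℕ) ^ (congruentNumberCurve n).mordellWeilRank = 2 ^ (2 * (congruentNumberCurve n).mordellWeilRank) := by
    rw [pow_mul]; norm_num
  constructor
  · intro h₈ x hx
    have h16 : Nat.card (AddSubgroup.torsionBy (congruentNumberCurve n).sha (4 : ℤ)) = 16 := by
      rw [h₈, h4pow] at hcount
      have h' : 2 ^ (2 * (congruentNumberCurve n).mordellWeilRank) *
          (4 * Nat.card (AddSubgroup.torsionBy (congruentNumberCurve n).sha (4 : ℤ))) =
          2 ^ (2 * (congruentNumberCurve n).mordellWeilRank) * 64 := by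
        rw [← mul_assoc, ← hcount, pow_add]; ring
      have h'' := Nat.eq_of_mul_eq_mul_left (pow_pos (by norm_num) _) h'
      omega
    have hrange : Nat.card g.range =
        Nat.card (AddSubgroup.torsionBy (congruentNumberCurve n).sha (2 : ℤ)) := by
      rw [hsha₂]; omega
    have htop : g.range = ⊤ := AddSubgroup.eq_top_of_card_eq g.range hrange
    have hxmem : (⟨x, (mem_sha_torsionBy_iff _ 2 x).mpr hx⟩ :
        AddSubgroup.torsionBy (congruentNumberCurve n).sha (2 : ℤ)) ∈ g.range := by
      rw [htop]; exact AddSubgroup.mem_top _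
    obtain ⟨w, hw⟩ := hxmem
    exact ⟨(w : (congruentNumberCurve n).sha), (mem_sha_torsionBy_iff _ 4 _).mp w.2, by rw [← hg, hw]⟩
  · intro hdiv
    have htop : g.range = ⊤ := by
      rw [eq_top_iff]
      rintro x -
      obtain ⟨w, hw4, hwx⟩ :=
        hdiv (x : (congruentNumberCurve n).sha) ((mem_sha_torsionBy_iff _ 2 _).mp x.2)
      exact ⟨⟨w, (mem_sha_torsionBy_iff _ 4 w).mpr hw4⟩, Subtype.ext (by rw [hg]; exact hwx)⟩
    have hrange : Nat.card g.range = 4 := by rw [htop, AddSubgroup.card_top, hsha₂]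
    have h16 : Nat.card (AddSubgroup.torsionBy (congruentNumberCurve n).sha (4 : ℤ)) = 16 := by omega
    rw [hcount, h16, h4pow]
    ring

/-- **(E) AT ANY RANK** (granted `casselsTate_pairing_levelKernel ℚ`): for square-free `n` of Mordell–Weil rank `r` with
`#Sel₂(E_n) = 2^{4+r}` (Selmer excess two), **`#Sel₄(E_n) = 2^{4+2r}` or `#Sel₄(E_n) = 2^{6+2r}`**.
[cite: MilneADT2006, Ch. I §6 Thm. 6.13(a), Lemma 6.17] [cite: Cassels1962ArithmeticIV] [cite: HeathBrown1994SelmerCongruentII, §1] -/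
theorem natCard_selmerGroup_four_eq_or_of_excess_two (hCT : casselsTate_pairing_levelKernel ℚ) (hsq : Squarefree n)
    [(congruentNumberCurve n).IsElliptic]
    (h₂ : Nat.card ((congruentNumberCurve n).selmerGroup 2) = 2 ^ (4 + (congruentNumberCurve n).mordellWeilRank)) :
    Nat.card ((congruentNumberCurve n).selmerGroup 4) = 2 ^ (4 + 2 * (congruentNumberCurve n).mordellWeilRank) ∨
      Nat.card ((congruentNumberCurve n).selmerGroup 4) = 2 ^ (6 + 2 * (congruentNumberCurve n).mordellWeilRank) := by
  rcases sha_dichotomy_of_natCard_sha_two_eq_four (congruentNumberCurve n) hCT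
      (natCard_sha_two_eq_four_of_excess_two hsq h₂) with hexp | hdiv
  · exact Or.inl ((natCard_selmerGroup_four_eq_pow_iff_of_excess_two hsq h₂).mpr hexp)
  · exact Or.inr ((natCard_selmerGroup_four_eq_pow_add_two_iff_of_excess_two hsq h₂).mpr hdiv)

/-- **The rank-zero partner case** (granted the CT fact): for square-free `n` with `rank E_n(ℚ) = 0` and `#Sel₂(E_n) = 2⁴` (e.g. `E_l`,
`l ≡ 1 (mod 8)` prime, when `L(E_l, 1) ≠ 0`), **`#Sel₄(E_n) = 2⁴ ∨ #Sel₄(E_n) = 2⁶`** — `Ш(E_n)[2^∞]`-side of the partner entry of the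
card (`#Sel₄ = 2⁴ ⟺ Ш[4] = Ш[2] ⟺ #Ш[2^∞] = 4`). [cite: MilneADT2006, Ch. I §6 Thm. 6.13(a), Lemma 6.17] [cite: Cassels1962ArithmeticIV] -/
theorem natCard_selmerGroup_four_eq_or_of_rank_zero (hCT : casselsTate_pairing_levelKernel ℚ) (hsq : Squarefree n)
    [(congruentNumberCurve n).IsElliptic] (hr : (congruentNumberCurve n).mordellWeilRank = 0)
    (h₂ : Nat.card ((congruentNumberCurve n).selmerGroup 2) = 2 ^ 4) :
    Nat.card ((congruentNumberCurve n).selmerGroup 4) = 2 ^ 4 ∨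
      Nat.card ((congruentNumberCurve n).selmerGroup 4) = 2 ^ 6 := by
  have h := natCard_selmerGroup_four_eq_or_of_excess_two hCT hsq (by rw [h₂, hr])
  rwa [hr] at h

end AnyRank

/-! ## Appendix (same seat, appended): the SIZE of the radical — `#ker π₂ · #Ш[2] = #Sel₂` -/

section RadicalSize

universe u

variable {K : Type u} [Field K] [NumberField K] (W : WeierstrassCurve K) [W.IsElliptic]

omit [W.IsElliptic] in
/-- **`#ker π₂ · #Ш(E/K)[2] = #Sel₂(E/K)`**: `π₂ : Sel₂(E/K) ↠ Ш(E/K)[2]` is onto (`exists_selmerToSha_eq`), so its kernel — the Kummer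
image `κ₂(E(K)) ≅ E(K)/2E(K)` — has index `#Ш[2]`. [cite: SilvermanAEC2009, Thm. X.4.2(a)] -/
theorem natCard_ker_selmerToSha_two_mul :
    Nat.card (selmerToSha W 2).ker * Nat.card (AddSubgroup.torsionBy W.sha (2 : ℤ)) =
      Nat.card (selmerGroup W 2) := by
  let f : selmerGroup W 2 →+ AddSubgroup.torsionBy W.sha (2 : ℤ) := (selmerToSha W 2).codRestrict _
    fun s => (mem_sha_torsionBy_iff W 2 _).mpr (zsmul_selmerToSha W 2 s)
  have hker : (selmerToSha W 2).ker = f.ker := by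
    ext s
    simp only [AddMonoidHom.mem_ker]
    exact ⟨fun h => Subtype.ext h, fun h => congrArg Subtype.val h⟩
  have hsurj : Function.Surjective f := by
    intro x
    obtain ⟨s, hs⟩ := exists_selmerToSha_eq W two_ne_zero (x : W.sha)
      ((mem_sha_torsionBy_iff W 2 _).mp x.2)
    exact ⟨s, Subtype.ext hs⟩
  rw [hker, ← AddSubgroup.card_top (G := AddSubgroup.torsionBy W.sha (2 : ℤ)),
    ← AddMonoidHom.range_eq_top.mpr hsurj, ← AddSubgroup.index_ker, AddSubgroup.card_mul_index]

end RadicalSize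

section RadicalSizeCongruent

variable {n : ℕ}

/-- **The radical has `2^{2+r}` classes**: for square-free `n` of rank `r` with `#Sel₂(E_n) = 2^{4+r}`, `#ker π₂ = 2^{2+r}` — the Kummer image
`κ₂(E_n(ℚ)) ≅ E_n(ℚ)/2E_n(ℚ) ≅ (ℤ/2)^{2+r}` (full rational `2`-torsion). In the PIN regime (`Ш[4] = Ш[2]`) this IS the radical of the
Cassels–Tate form (`range_selmerZSMul_two_eq_ker_of_sha`): `2³` classes on the jump-one class (`r = 1`), `2²` for a rank-zero partner.
[cite: SilvermanAEC2009, Thm. X.4.2] [cite: HeathBrown1994SelmerCongruentII, §1] -/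
theorem natCard_ker_selmerToSha_two_of_excess_two (hsq : Squarefree n) [(congruentNumberCurve n).IsElliptic]
    (h₂ : Nat.card ((congruentNumberCurve n).selmerGroup 2) = 2 ^ (4 + (congruentNumberCurve n).mordellWeilRank)) :
    Nat.card (selmerToSha (congruentNumberCurve n) 2).ker = 2 ^ (2 + (congruentNumberCurve n).mordellWeilRank) := by
  have h := natCard_ker_selmerToSha_two_mul (congruentNumberCurve n)
  rw [natCard_sha_two_eq_four_of_excess_two hsq h₂, h₂, show 4 + (congruentNumberCurve n).mordellWeilRank =
    (2 + (congruentNumberCurve n).mordellWeilRank) + 2 by omega, pow_add] at h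
  exact Nat.eq_of_mul_eq_mul_right (by norm_num : 0 < 2 ^ 2) h

/-- **On the jump-one class the radical of the Cassels–Tate form has exactly `8` classes**: for square-free `n` of rank `1` with
`#Sel₂(E_n) = 2⁵`, `#ker π₂ = 2³` — and when `#Sel₄(E_n) = 2⁶` this kernel IS the radical `[2]_* Sel₄(E_n)` (part 2,
`range_selmerZSMul_two_eq_ker_of_sha` / `pin_of_selmerFour`): the `4` torsion classes `κ₂(E_n[2])` and the `4` classes of the coset of a
generator. [cite: SilvermanAEC2009, Thm. X.4.2] [cite: HeathBrown1994SelmerCongruentII, §1] -/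
theorem natCard_ker_selmerToSha_two_eq_eight (hsq : Squarefree n) [(congruentNumberCurve n).IsElliptic]
    (hr : (congruentNumberCurve n).mordellWeilRank = 1)
    (h₂ : Nat.card ((congruentNumberCurve n).selmerGroup 2) = 2 ^ 5) :
    Nat.card (selmerToSha (congruentNumberCurve n) 2).ker = 8 := by
  rw [natCard_ker_selmerToSha_two_of_excess_two hsq (by rw [h₂, hr]), hr]
  norm_num

end RadicalSizeCongruent

end Summit.BirchSwinnertonDyer.PrintCf2.CasselsTatePin

end
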